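import Summits.BirchSwinnertonDyer.Rank1Residual.AdditivePotMult.NonPrimitiveSelmerTransferCountOdd
import Summits.BirchSwinnertonDyer.Rank1Residual.X2.MuTransferDerived
import Summits.BirchSwinnertonDyer.Rank1Residual.X2.SelmerCotorsionOfFiniteTorsion
import HarnessLib

/-!
# GV Prop. (2.8)'s "Consequently" and p. 27's `μ`-clause for the NON-PRIMITIVE Selmer duals at every
# odd additive prime of the four loci: `Sel^{Σ₀}_{E₂}(ℚ_∞)_p` is `Λ`-COTORSION with `μ = 0` as soon as
# the congruent partner's is — kernel, modulo `hGrK` (A239) on the (G-ord) side / A40–A41 on the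
# (M) side (cell `b2b-bsdres`, team n1011, seat p12 (gen 5); row T-E3g-GV29o FILE 4; ROUTE-2 II.15.4
# ARM α, the `μ`-half of the `Λ`-reading)

HONEST FRAMING (cell `b2b-bsdres`, run/shared/lean/b2b/bsd-rank1-residual/, verbatim in every
file): the goal of the cell is to DELETE the COMBINATION-SHAPED residual classes of the
Birch–Swinnerton-Dyer formula for ALL analytic-rank `≤ 1` elliptic curves over `ℚ` — "full BSD
formula for every rank `≤ 1` curve in class `C`" assembled STRICTLY from published theorems — so
that the rank-`≤ 1` remainder becomes exactly the CONSTRUCTION-SHAPED classes, which are TYPED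
(missing-input `Prop`s), NOT attempted. This is not "finishing BSD". Team n1011: research routes on
CONSTRUCTION-SHAPED classes; prove what is provable now; no claim beyond stated classes; census
output = EVIDENCE, never a Literature fact; RESIDUAL-MAP marks UNCHANGED; nothing is booked by this
file. THEOREMS ONLY: no definition, no named fact; eisenstein-p2's `X2.MuTransferDerived`,
`X2.NonPrimitiveSelmerTorsionCard`, `X2.MuVanishingOfFiniteModP`, `X2.SelmerCotorsionOfFiniteTorsion`,
`X2.NonPrimitiveSelmerDual` are consumed BY NAME and untouched.

## What and why

GV Prop. (2.8) (arXiv:math/9906215 p. 25): "Consequently, `S_A(ℚ_∞)` is `Λ`-cotorsion and has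
`μ`-invariant zero if and only if `S^{Σ₀}_{A[π]}(ℚ_∞)` is finite"; p. 27: "As a consequence, we see that
if `μ_{E₁} = 0`, then `μ_{E₂} = 0`". FILE 3 proved `#Sel^{Σ₀}_{E₁}(ℚ_∞)_p[p] = #Sel^{Σ₀}_{E₂}(ℚ_∞)_p[p]`
on the four loci. The `μ`-half of the `Λ`-reading for the NON-PRIMITIVE duals `X^{Σ₀}_i =
Hom(Sel^{Σ₀}_{E_i}(ℚ_∞)_p, ℚ/ℤ)` (`NonPrimitiveDualData`) is pure algebra already in the tree
(eisenstein-p2): `μ(X^{Σ₀}_1) = 0` with `X^{Σ₀}_1` f.g. torsion ⟹ `X^{Σ₀}_1` f.g. over `ℤ_p` ⟹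
`Sel^{Σ₀}_{E₁}[p]` finite (`finite_torsionBy_of_addEquiv`) ⟹ (count) `Sel^{Σ₀}_{E₂}[p]` finite ⟹
`X^{Σ₀}_2/p` finite (`finite_modN_characterModule_of_finite_torsionBy`) ⟹ `X^{Σ₀}_2` is `Λ`-TORSION
(`isTorsion_of_finite_modN`) with `μ(X^{Σ₀}_2) = 0` (`muInvariant_eq_zero_of_finite_modN'`).

* §1 (any `E/ℚ`, any `κ`, `γ`, `Σ₀`) `finite_torsionBy_nonPrimitiveSelmerInfty_of_mu_eq_zero`,
  `nonPrimitive_isTorsion_and_mu_eq_zero_of_finite_torsionBy`,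
  `nonPrimitive_isTorsion_and_mu_eq_zero_of_natCard_eq` (the transfer along an equality of counts).
* §2 the four loci (FILE 3's counts): `ClassX4Gord/ClassX3Gord.nonPrimitive_isTorsion_and_mu_eq_zero_of_torsionIso`
  (mod `hGrK`), `ClassX4M/ClassX3M.…` (mod A40/A41), mixed `ClassX4M.…_of_classX4Gord`,
  `ClassX4M.…_of_classX4Gord_rev` (reverse direction), `ClassX3M.…_of_classX3Gord`: for ANY f.g. non-primitive dual data,
  `X^{Σ₀}_1` torsion with `μ = 0` ⟹ `X^{Σ₀}_2` torsion with `μ = 0`.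

NOT given here (what remains of A240 after FILES 1–4): the passage between PRIMITIVE and
non-primitive invariants (`μ(X) = μ(X^{Σ₀})`, `λ(X^{Σ₀}) = λ(X) + Σδ` — GV (7) / Cor. (2.3), printed
for good ordinary or multiplicative `p` only) and `#Sel^{Σ₀}[p] = p^{λ(X^{Σ₀})}` (Prop. (2.5) /
Remark (2.7)); typer lane. Nothing booked; X3♯/X4♯ stay as labelled.

References: [GreenbergVatsal2000] §2 Prop. (2.8) (p. 25), pp. 26–27; [Washington1997] §13.2;
ROUTE-2 II.15.4.
-/

set_option autoImplicit false

noncomputable section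

open scoped Classical NumberField AddSubgroup

open NumberField IsDedekindDomain Field WeierstrassCurve
  Literature.NumberTheory.GaloisRepresentations Literature.NumberTheory.EllipticCurves
  Literature.NumberTheory.EllipticCurves.GreenbergSelmer
  Literature.NumberTheory.EllipticCurves.GreenbergVatsal2000
  Literature.NumberTheory.EllipticCurves.EmertonPollackWeston2006
  Literature.NumberTheory.EllipticCurves.Rank1Residual
  Literature.NumberTheory.EllipticCurves.Greenberg1999
  Summit.BirchSwinnertonDyer.Rank1Residual.X2.NonPrimitiveSelmerDual
  Summit.BirchSwinnertonDyer.Rank1Residual.X2.NonPrimitiveSelmerTorsionCard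
  Summit.BirchSwinnertonDyer.Rank1Residual.X2.MuTransferDerived
  Summit.BirchSwinnertonDyer.Rank1Residual.X2.MuVanishingOfFiniteModP
  Summit.BirchSwinnertonDyer.Rank1Residual.X2.SelmerCotorsionOfFiniteTorsion

/-! ## §1. Algebra: cotorsion + `μ = 0` ⟺ finite `p`-torsion, for the non-primitive duals -/

namespace Summit.BirchSwinnertonDyer.Rank1Residual.Additive

open Summit.BirchSwinnertonDyer.Rank1Residual.X1.CongruenceTransfer (TorsionIso)

section Algebra

variable {p : ℕ} [hp : Fact p.Prime] {W : WeierstrassCurve ℚ} (κ : ZpExtension ℚ p)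
  {γ : absoluteGaloisGroup ℚ} (S₀ : Set (HeightOneSpectrum (𝓞 ℚ)))

/-- **`X^{Σ₀}` torsion with `μ = 0` ⟹ `Sel^{Σ₀}_E(ℚ_∞)_p[p]` finite** (any `E/ℚ`, `κ`, `Σ₀`; any f.g.
non-primitive dual datum): `μ = 0` makes `X^{Σ₀}` finitely generated over `ℤ_p`
(`moduleFinite_int_of_muInvariant_eq_zero`), and a group with f.g.-over-`ℤ_p` character group has
finite `p`-torsion (`finite_torsionBy_of_addEquiv`). GV Prop. (2.8), "only if".
[cite: GreenbergVatsal2000, §2 Prop. (2.8) (arXiv:math/9906215 p. 25)] [cite: Washington1997, §13.2] -/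
theorem finite_torsionBy_nonPrimitiveSelmerInfty_of_mu_eq_zero (DS : NonPrimitiveDualData W κ γ S₀)
    [Module.Finite (IwasawaAlgebra p) DS.X] (ht : Module.IsTorsion (IwasawaAlgebra p) DS.X)
    (hμ : muInvariant p DS.X = 0) :
    Finite ((nonPrimitiveSelmerInfty W κ S₀)[(p : ℤ)]) := by
  letI : Module ℤ_[p] DS.X := Module.compHom DS.X (algebraMap ℤ_[p] (IwasawaAlgebra p))
  haveI : IsScalarTower ℤ_[p] (IwasawaAlgebra p) DS.X := IsScalarTower.of_compHom ℤ_[p] _ DS.X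
  haveI : Module.Finite ℤ_[p] DS.X := moduleFinite_int_of_muInvariant_eq_zero p DS.X ht hμ
  exact finite_torsionBy_of_addEquiv p (toDualEquiv W κ S₀ DS)

/-- **`Sel^{Σ₀}_E(ℚ_∞)_p[p]` finite ⟹ every f.g. `X^{Σ₀}` is `Λ`-TORSION with `μ = 0`**:
`X^{Σ₀}/p ≅ Hom(Sel^{Σ₀}, ℚ/ℤ)/p ↪ Hom(Sel^{Σ₀}[p], ℚ/ℤ)` is finite
(`finite_modN_characterModule_of_finite_torsionBy`), so `X^{Σ₀}` is torsion
(`isTorsion_of_finite_modN`) with `μ = 0` (`muInvariant_eq_zero_of_finite_modN'`). GV Prop. (2.8), "if".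
[cite: GreenbergVatsal2000, §2 Prop. (2.8) (arXiv:math/9906215 p. 25)] [cite: Washington1997, §13.2] -/
theorem nonPrimitive_isTorsion_and_mu_eq_zero_of_finite_torsionBy
    (DS : NonPrimitiveDualData W κ γ S₀) [Module.Finite (IwasawaAlgebra p) DS.X]
    [Finite ((nonPrimitiveSelmerInfty W κ S₀)[(p : ℤ)])] :
    Module.IsTorsion (IwasawaAlgebra p) DS.X ∧ muInvariant p DS.X = 0 := by
  haveI : Finite (ModN (CharacterModule (nonPrimitiveSelmerInfty W κ S₀)) p) :=
    finite_modN_characterModule_of_finite_torsionBy p (S := nonPrimitiveSelmerInfty W κ S₀)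
  haveI : Finite (ModN DS.X p) :=
    Finite.of_equiv _ (modNEquiv (toDualEquiv W κ S₀ DS) p).symm.toEquiv
  have ht : Module.IsTorsion (IwasawaAlgebra p) DS.X := isTorsion_of_finite_modN p DS.X
  exact ⟨ht, muInvariant_eq_zero_of_finite_modN' p DS.X ht inferInstance⟩

end Algebra

section Transfer

variable {p : ℕ} [hp : Fact p.Prime] {W₁ W₂ : WeierstrassCurve ℚ} (κ : ZpExtension ℚ p)
  {γ : absoluteGaloisGroup ℚ} (S₀ : Set (HeightOneSpectrum (𝓞 ℚ)))

/-- **The transfer along an equality of counts** (GV p. 27 "if `μ_{E₁} = 0`, then `μ_{E₂} = 0`", for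
the non-primitive duals): if `#Sel^{Σ₀}_{E₁}[p] = #Sel^{Σ₀}_{E₂}[p]` and some f.g. dual datum of
`Sel^{Σ₀}_{E₁}` is torsion with `μ = 0`, then EVERY f.g. dual datum of `Sel^{Σ₀}_{E₂}` is torsion with
`μ = 0`. [cite: GreenbergVatsal2000, §2 Prop. (2.8) and pp. 26–27] -/
theorem nonPrimitive_isTorsion_and_mu_eq_zero_of_natCard_eq
    (hcount : Nat.card ((nonPrimitiveSelmerInfty W₁ κ S₀)[(p : ℤ)]) =
      Nat.card ((nonPrimitiveSelmerInfty W₂ κ S₀)[(p : ℤ)]))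
    (DS₁ : NonPrimitiveDualData W₁ κ γ S₀) (DS₂ : NonPrimitiveDualData W₂ κ γ S₀)
    [Module.Finite (IwasawaAlgebra p) DS₁.X] [Module.Finite (IwasawaAlgebra p) DS₂.X]
    (ht₁ : Module.IsTorsion (IwasawaAlgebra p) DS₁.X) (hμ₁ : muInvariant p DS₁.X = 0) :
    Module.IsTorsion (IwasawaAlgebra p) DS₂.X ∧ muInvariant p DS₂.X = 0 := by
  haveI := finite_torsionBy_nonPrimitiveSelmerInfty_of_mu_eq_zero κ S₀ DS₁ ht₁ hμ₁
  have hne : Nat.card ((nonPrimitiveSelmerInfty W₂ κ S₀)[(p : ℤ)]) ≠ 0 := by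
    rw [← hcount]
    exact Nat.card_pos.ne'
  haveI : Finite ((nonPrimitiveSelmerInfty W₂ κ S₀)[(p : ℤ)]) := Nat.finite_of_card_ne_zero hne
  exact nonPrimitive_isTorsion_and_mu_eq_zero_of_finite_torsionBy κ S₀ DS₂

end Transfer

/-! ## §2. The four loci -/

section Gord

variable {p : ℕ} [hp : Fact p.Prime] {W₁ W₂ : WeierstrassCurve ℚ} [W₁.IsElliptic]
  [W₁.IsGloballyMinimal] [W₂.IsElliptic] [W₂.IsGloballyMinimal] (κ : ZpExtension ℚ p)
  {γ : absoluteGaloisGroup ℚ} (S₀ : Set (HeightOneSpectrum (𝓞 ℚ)))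

/-- **X4♯(G-ord, `e = 2`) pairs, every odd `p`: `Sel^{Σ₀}_{E₂}(ℚ_∞)_p` is `Λ`-cotorsion with `μ = 0`
as soon as `Sel^{Σ₀}_{E₁}(ℚ_∞)_p` is** (for their f.g. duals), modulo `hGrK` (A239) only; `κ` cyclotomic,
`Σ₀ ∌ p ⊇` bad primes, `E₁[p] ≅ E₂[p]`. X4♯ stays CONSTRUCTION-SHAPED; nothing booked.
[cite: GreenbergVatsal2000, §2 Prop. (2.8) and pp. 26–27] [cite: GreenbergLNM1716, §2 Prop. 2.4 (p. 80)] -/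
theorem ClassX4Gord.nonPrimitive_isTorsion_and_mu_eq_zero_of_torsionIso
    (hGrK : imKummer_ge_strictCondition_goodOrdinary) (hκ : κ.IsCyclotomic)
    (hX₁ : ClassX4Gord W₁ p) (he₁ : semistabilityIndex W₁ p = 2)
    (hX₂ : ClassX4Gord W₂ p) (he₂ : semistabilityIndex W₂ p = 2)
    (hS₀ : ∀ v ∈ S₀, ((p : ℕ) : 𝓞 ℚ) ∉ v.asIdeal)
    (hS₁ : ∀ v : HeightOneSpectrum (𝓞 ℚ), v ∉ S₀ → ((p : ℕ) : 𝓞 ℚ) ∉ v.asIdeal →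
      W₁.HasGoodReductionAt v)
    (hS₂ : ∀ v : HeightOneSpectrum (𝓞 ℚ), v ∉ S₀ → ((p : ℕ) : 𝓞 ℚ) ∉ v.asIdeal →
      W₂.HasGoodReductionAt v)
    (hT : TorsionIso W₁ W₂ p)
    (DS₁ : NonPrimitiveDualData W₁ κ γ S₀) (DS₂ : NonPrimitiveDualData W₂ κ γ S₀)
    [Module.Finite (IwasawaAlgebra p) DS₁.X] [Module.Finite (IwasawaAlgebra p) DS₂.X]
    (ht₁ : Module.IsTorsion (IwasawaAlgebra p) DS₁.X) (hμ₁ : muInvariant p DS₁.X = 0) :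
    Module.IsTorsion (IwasawaAlgebra p) DS₂.X ∧ muInvariant p DS₂.X = 0 :=
  nonPrimitive_isTorsion_and_mu_eq_zero_of_natCard_eq κ S₀
    (ClassX4Gord.natCard_torsionBy_nonPrimitiveSelmerInfty_eq κ S₀ hGrK hκ hX₁ he₁ hX₂ he₂ hS₀ hS₁
      hS₂ hT) DS₁ DS₂ ht₁ hμ₁

/-- **X3♯(G-ord, `e = 2`) pairs, odd `p` (REDUCIBLE `E_i[p]`): the same**, with the census bit
`p ∤ #E₁(ℚ)_tors`; mod `hGrK`. X3♯ stays as labelled; nothing booked.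
[cite: GreenbergVatsal2000, §2 Prop. (2.8) and pp. 26–27] [cite: GreenbergLNM1716, §2 Prop. 2.4 (p. 80)] -/
theorem ClassX3Gord.nonPrimitive_isTorsion_and_mu_eq_zero_of_torsionIso
    (hGrK : imKummer_ge_strictCondition_goodOrdinary) (hp2 : p ≠ 2) (hκ : κ.IsCyclotomic)
    (hX₁ : ClassX3Gord W₁ p) (he₁ : semistabilityIndex W₁ p = 2)
    (hX₂ : ClassX3Gord W₂ p) (he₂ : semistabilityIndex W₂ p = 2)
    (htors₁ : ¬ p ∣ W₁.torsionOrder)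
    (hS₀ : ∀ v ∈ S₀, ((p : ℕ) : 𝓞 ℚ) ∉ v.asIdeal)
    (hS₁ : ∀ v : HeightOneSpectrum (𝓞 ℚ), v ∉ S₀ → ((p : ℕ) : 𝓞 ℚ) ∉ v.asIdeal →
      W₁.HasGoodReductionAt v)
    (hS₂ : ∀ v : HeightOneSpectrum (𝓞 ℚ), v ∉ S₀ → ((p : ℕ) : 𝓞 ℚ) ∉ v.asIdeal →
      W₂.HasGoodReductionAt v)
    (hT : TorsionIso W₁ W₂ p)
    (DS₁ : NonPrimitiveDualData W₁ κ γ S₀) (DS₂ : NonPrimitiveDualData W₂ κ γ S₀)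
    [Module.Finite (IwasawaAlgebra p) DS₁.X] [Module.Finite (IwasawaAlgebra p) DS₂.X]
    (ht₁ : Module.IsTorsion (IwasawaAlgebra p) DS₁.X) (hμ₁ : muInvariant p DS₁.X = 0) :
    Module.IsTorsion (IwasawaAlgebra p) DS₂.X ∧ muInvariant p DS₂.X = 0 :=
  nonPrimitive_isTorsion_and_mu_eq_zero_of_natCard_eq κ S₀
    (ClassX3Gord.natCard_torsionBy_nonPrimitiveSelmerInfty_eq κ S₀ hGrK hp2 hκ hX₁ he₁ hX₂ he₂ htors₁
      hS₀ hS₁ hS₂ hT) DS₁ DS₂ ht₁ hμ₁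

end Gord

end Summit.BirchSwinnertonDyer.Rank1Residual.Additive

namespace Summit.BirchSwinnertonDyer.Rank1Residual.AdditivePotMult

open Summit.BirchSwinnertonDyer.Rank1Residual.Additive
open Summit.BirchSwinnertonDyer.Rank1Residual.X1.CongruenceTransfer (TorsionIso)

section PotMultPairs

variable {p : ℕ} [hp : Fact p.Prime] {W₁ W₂ : WeierstrassCurve ℚ} [W₁.IsElliptic] [W₂.IsElliptic]
  (κ : ZpExtension ℚ p) {γ : absoluteGaloisGroup ℚ} (S₀ : Set (HeightOneSpectrum (𝓞 ℚ)))

/-- **X4(M) pairs, every odd `p`: `Sel^{Σ₀}_{E₂}(ℚ_∞)_p` is `Λ`-cotorsion with `μ = 0` as soon as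
`Sel^{Σ₀}_{E₁}(ℚ_∞)_p` is** (f.g. duals), mod A40/A41. X4(M) stays CONSTRUCTION-SHAPED; nothing booked.
[cite: GreenbergVatsal2000, §2 Prop. (2.8) and pp. 26–27] [cite: SilvermanATAEC1994, Ch. V Thm. 5.3, Cor. 5.4] -/
theorem ClassX4M.nonPrimitive_isTorsion_and_mu_eq_zero_of_torsionIso
    (hT40 : Silverman1994_thmV53_tateUniformisation.{0})
    (hT41 : Silverman1994_thmV53_corV54_tateUniformisation.{0}) (hκ : κ.IsCyclotomic)
    (hX₁ : ClassX4M W₁ p) (hX₂ : ClassX4M W₂ p)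
    (hS₀ : ∀ v ∈ S₀, ((p : ℕ) : 𝓞 ℚ) ∉ v.asIdeal)
    (hS₁ : ∀ v : HeightOneSpectrum (𝓞 ℚ), v ∉ S₀ → ((p : ℕ) : 𝓞 ℚ) ∉ v.asIdeal →
      W₁.HasGoodReductionAt v)
    (hS₂ : ∀ v : HeightOneSpectrum (𝓞 ℚ), v ∉ S₀ → ((p : ℕ) : 𝓞 ℚ) ∉ v.asIdeal →
      W₂.HasGoodReductionAt v)
    (hT : TorsionIso W₁ W₂ p)
    (DS₁ : NonPrimitiveDualData W₁ κ γ S₀) (DS₂ : NonPrimitiveDualData W₂ κ γ S₀)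
    [Module.Finite (IwasawaAlgebra p) DS₁.X] [Module.Finite (IwasawaAlgebra p) DS₂.X]
    (ht₁ : Module.IsTorsion (IwasawaAlgebra p) DS₁.X) (hμ₁ : muInvariant p DS₁.X = 0) :
    Module.IsTorsion (IwasawaAlgebra p) DS₂.X ∧ muInvariant p DS₂.X = 0 :=
  nonPrimitive_isTorsion_and_mu_eq_zero_of_natCard_eq κ S₀
    (ClassX4M.natCard_torsionBy_nonPrimitiveSelmerInfty_eq κ S₀ hT40 hT41 hκ hX₁ hX₂ hS₀ hS₁ hS₂ hT)
    DS₁ DS₂ ht₁ hμ₁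

/-- **X3♯(M) pairs, odd `p` (REDUCIBLE `E_i[p]`): the same**, with the census bit `p ∤ #E₁(ℚ)_tors`;
mod A40/A41. X3♯(M) stays as labelled; nothing booked.
[cite: GreenbergVatsal2000, §2 Prop. (2.8) and pp. 26–27] [cite: SilvermanATAEC1994, Ch. V Thm. 5.3, Cor. 5.4] -/
theorem ClassX3M.nonPrimitive_isTorsion_and_mu_eq_zero_of_torsionIso [W₁.IsGloballyMinimal]
    [W₂.IsGloballyMinimal] (hT40 : Silverman1994_thmV53_tateUniformisation.{0})
    (hT41 : Silverman1994_thmV53_corV54_tateUniformisation.{0}) (hκ : κ.IsCyclotomic)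
    (hX₁ : ClassX3M W₁ p) (hX₂ : ClassX3M W₂ p) (htors₁ : ¬ p ∣ W₁.torsionOrder)
    (hS₀ : ∀ v ∈ S₀, ((p : ℕ) : 𝓞 ℚ) ∉ v.asIdeal)
    (hS₁ : ∀ v : HeightOneSpectrum (𝓞 ℚ), v ∉ S₀ → ((p : ℕ) : 𝓞 ℚ) ∉ v.asIdeal →
      W₁.HasGoodReductionAt v)
    (hS₂ : ∀ v : HeightOneSpectrum (𝓞 ℚ), v ∉ S₀ → ((p : ℕ) : 𝓞 ℚ) ∉ v.asIdeal →
      W₂.HasGoodReductionAt v)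
    (hT : TorsionIso W₁ W₂ p)
    (DS₁ : NonPrimitiveDualData W₁ κ γ S₀) (DS₂ : NonPrimitiveDualData W₂ κ γ S₀)
    [Module.Finite (IwasawaAlgebra p) DS₁.X] [Module.Finite (IwasawaAlgebra p) DS₂.X]
    (ht₁ : Module.IsTorsion (IwasawaAlgebra p) DS₁.X) (hμ₁ : muInvariant p DS₁.X = 0) :
    Module.IsTorsion (IwasawaAlgebra p) DS₂.X ∧ muInvariant p DS₂.X = 0 :=
  nonPrimitive_isTorsion_and_mu_eq_zero_of_natCard_eq κ S₀
    (ClassX3M.natCard_torsionBy_nonPrimitiveSelmerInfty_eq κ S₀ hT40 hT41 hκ hX₁ hX₂ htors₁ hS₀ hS₁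
      hS₂ hT) DS₁ DS₂ ht₁ hμ₁

end PotMultPairs

section Mixed

variable {p : ℕ} [hp : Fact p.Prime] {W₁ W₂ : WeierstrassCurve ℚ} [W₁.IsElliptic]
  [W₁.IsGloballyMinimal] [W₂.IsElliptic] (κ : ZpExtension ℚ p) {γ : absoluteGaloisGroup ℚ}
  (S₀ : Set (HeightOneSpectrum (𝓞 ℚ)))

/-- **X4♯(G-ord, `e = 2`) × X4(M), every odd `p`: the (M) partner's `Sel^{Σ₀}` is `Λ`-cotorsion with
`μ = 0` as soon as the (G-ord) curve's is** (f.g. duals), mod `hGrK` / A40–A41. Nothing booked.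
[cite: GreenbergVatsal2000, §2 Prop. (2.8) and pp. 26–27] [cite: SilvermanATAEC1994, Ch. V Thm. 5.3, Cor. 5.4] -/
theorem ClassX4M.nonPrimitive_isTorsion_and_mu_eq_zero_of_classX4Gord
    (hGrK : imKummer_ge_strictCondition_goodOrdinary)
    (hT40 : Silverman1994_thmV53_tateUniformisation.{0})
    (hT41 : Silverman1994_thmV53_corV54_tateUniformisation.{0}) (hκ : κ.IsCyclotomic)
    (hX₁ : ClassX4Gord W₁ p) (he₁ : semistabilityIndex W₁ p = 2) (hX₂ : ClassX4M W₂ p)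
    (hS₀ : ∀ v ∈ S₀, ((p : ℕ) : 𝓞 ℚ) ∉ v.asIdeal)
    (hS₁ : ∀ v : HeightOneSpectrum (𝓞 ℚ), v ∉ S₀ → ((p : ℕ) : 𝓞 ℚ) ∉ v.asIdeal →
      W₁.HasGoodReductionAt v)
    (hS₂ : ∀ v : HeightOneSpectrum (𝓞 ℚ), v ∉ S₀ → ((p : ℕ) : 𝓞 ℚ) ∉ v.asIdeal →
      W₂.HasGoodReductionAt v)
    (hT : TorsionIso W₁ W₂ p)
    (DS₁ : NonPrimitiveDualData W₁ κ γ S₀) (DS₂ : NonPrimitiveDualData W₂ κ γ S₀)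
    [Module.Finite (IwasawaAlgebra p) DS₁.X] [Module.Finite (IwasawaAlgebra p) DS₂.X]
    (ht₁ : Module.IsTorsion (IwasawaAlgebra p) DS₁.X) (hμ₁ : muInvariant p DS₁.X = 0) :
    Module.IsTorsion (IwasawaAlgebra p) DS₂.X ∧ muInvariant p DS₂.X = 0 :=
  nonPrimitive_isTorsion_and_mu_eq_zero_of_natCard_eq κ S₀
    (ClassX4M.natCard_torsionBy_nonPrimitiveSelmerInfty_eq_of_classX4Gord κ S₀ hGrK hT40 hT41 hκ hX₁
      he₁ hX₂ hS₀ hS₁ hS₂ hT) DS₁ DS₂ ht₁ hμ₁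

/-- **X4(M) × X4♯(G-ord, `e = 2`) — the REVERSE direction: the (G-ord) partner's `Sel^{Σ₀}` is
`Λ`-cotorsion with `μ = 0` as soon as the (M) curve's is** (the count is symmetric). Nothing booked.
[cite: GreenbergVatsal2000, §2 Prop. (2.8) and pp. 26–27] [cite: SilvermanATAEC1994, Ch. V Thm. 5.3, Cor. 5.4] -/
theorem ClassX4M.nonPrimitive_isTorsion_and_mu_eq_zero_of_classX4Gord_rev
    (hGrK : imKummer_ge_strictCondition_goodOrdinary)
    (hT40 : Silverman1994_thmV53_tateUniformisation.{0})
    (hT41 : Silverman1994_thmV53_corV54_tateUniformisation.{0}) (hκ : κ.IsCyclotomic)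
    (hX₁ : ClassX4Gord W₁ p) (he₁ : semistabilityIndex W₁ p = 2) (hX₂ : ClassX4M W₂ p)
    (hS₀ : ∀ v ∈ S₀, ((p : ℕ) : 𝓞 ℚ) ∉ v.asIdeal)
    (hS₁ : ∀ v : HeightOneSpectrum (𝓞 ℚ), v ∉ S₀ → ((p : ℕ) : 𝓞 ℚ) ∉ v.asIdeal →
      W₁.HasGoodReductionAt v)
    (hS₂ : ∀ v : HeightOneSpectrum (𝓞 ℚ), v ∉ S₀ → ((p : ℕ) : 𝓞 ℚ) ∉ v.asIdeal →
      W₂.HasGoodReductionAt v)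
    (hT : TorsionIso W₁ W₂ p)
    (DS₁ : NonPrimitiveDualData W₁ κ γ S₀) (DS₂ : NonPrimitiveDualData W₂ κ γ S₀)
    [Module.Finite (IwasawaAlgebra p) DS₁.X] [Module.Finite (IwasawaAlgebra p) DS₂.X]
    (ht₂ : Module.IsTorsion (IwasawaAlgebra p) DS₂.X) (hμ₂ : muInvariant p DS₂.X = 0) :
    Module.IsTorsion (IwasawaAlgebra p) DS₁.X ∧ muInvariant p DS₁.X = 0 :=
  nonPrimitive_isTorsion_and_mu_eq_zero_of_natCard_eq κ S₀
    (ClassX4M.natCard_torsionBy_nonPrimitiveSelmerInfty_eq_of_classX4Gord κ S₀ hGrK hT40 hT41 hκ hX₁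
      he₁ hX₂ hS₀ hS₁ hS₂ hT).symm DS₂ DS₁ ht₂ hμ₂

/-- **X3♯(G-ord, `e = 2`) × X3♯(M), odd `p`**: the (M) partner's `Sel^{Σ₀}` is `Λ`-cotorsion with
`μ = 0` as soon as the (G-ord) curve's is (f.g. duals; census bit `p ∤ #E₁(ℚ)_tors`), mod `hGrK` /
A40–A41. Nothing booked. [cite: GreenbergVatsal2000, §2 Prop. (2.8) and pp. 26–27]
[cite: SilvermanATAEC1994, Ch. V Thm. 5.3, Cor. 5.4] -/
theorem ClassX3M.nonPrimitive_isTorsion_and_mu_eq_zero_of_classX3Gord [W₂.IsGloballyMinimal]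
    (hGrK : imKummer_ge_strictCondition_goodOrdinary)
    (hT40 : Silverman1994_thmV53_tateUniformisation.{0})
    (hT41 : Silverman1994_thmV53_corV54_tateUniformisation.{0}) (hp2 : p ≠ 2) (hκ : κ.IsCyclotomic)
    (hX₁ : ClassX3Gord W₁ p) (he₁ : semistabilityIndex W₁ p = 2) (hX₂ : ClassX3M W₂ p)
    (htors₁ : ¬ p ∣ W₁.torsionOrder)
    (hS₀ : ∀ v ∈ S₀, ((p : ℕ) : 𝓞 ℚ) ∉ v.asIdeal)
    (hS₁ : ∀ v : HeightOneSpectrum (𝓞 ℚ), v ∉ S₀ → ((p : ℕ) : 𝓞 ℚ) ∉ v.asIdeal →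
      W₁.HasGoodReductionAt v)
    (hS₂ : ∀ v : HeightOneSpectrum (𝓞 ℚ), v ∉ S₀ → ((p : ℕ) : 𝓞 ℚ) ∉ v.asIdeal →
      W₂.HasGoodReductionAt v)
    (hT : TorsionIso W₁ W₂ p)
    (DS₁ : NonPrimitiveDualData W₁ κ γ S₀) (DS₂ : NonPrimitiveDualData W₂ κ γ S₀)
    [Module.Finite (IwasawaAlgebra p) DS₁.X] [Module.Finite (IwasawaAlgebra p) DS₂.X]
    (ht₁ : Module.IsTorsion (IwasawaAlgebra p) DS₁.X) (hμ₁ : muInvariant p DS₁.X = 0) :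
    Module.IsTorsion (IwasawaAlgebra p) DS₂.X ∧ muInvariant p DS₂.X = 0 :=
  nonPrimitive_isTorsion_and_mu_eq_zero_of_natCard_eq κ S₀
    (ClassX3M.natCard_torsionBy_nonPrimitiveSelmerInfty_eq_of_classX3Gord κ S₀ hGrK hT40 hT41 hp2 hκ
      hX₁ he₁ hX₂ htors₁ hS₀ hS₁ hS₂ hT) DS₁ DS₂ ht₁ hμ₁

end Mixed

end Summit.BirchSwinnertonDyer.Rank1Residual.AdditivePotMult

end
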